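import Summits.ResolutionOfSingularities.ResolutionOfSingularities.Theorems.DecompositionDescentLU5
import Summits.ResolutionOfSingularities.ResolutionOfSingularities.Theorems.TameAbelianQuotientLU4
import HarnessLib

/-!
# DecompositionDescentLU (8/7+1) — the owed 0-weight anchoring of g26's residual: `R26 ↔ R27`

Slice 8 of the g27 node `DecompositionDescentLU` (WRITER.md §afterG26; critic rows 202/207 (i5): owed, 0-weight):
the tame-ABELIAN located residual `R26 = TameAbelianQuotientLU.NonKHToricArchLUKeyHenselDescentAbel` of g26 is
re-anchored to g27's residual `R27 = NonKHToricArchLUKeyHenselDescentQuotDec` through g25's `R25`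
(`TameAbelianQuotientLU.nonKHToricArchLUKeyHenselDescentQuot_iff_abel : R25 ↔ R26`, tree;
`nonKHToricArchLUKeyHenselDescentQuot_iff_dec : R25 ↔ R27`, slice 5).  Problem side, sorry-free, hypothesis-free.
-/

namespace Summit.ResolutionOfSingularities.ResolutionOfSingularities.Theorems.DecompositionDescentLU

open Summit.ResolutionOfSingularities.ResolutionOfSingularities.Theorems

/-- **`R26 ↔ R27`** (kernel, exact, hypothesis-free): g26's tame-abelian located residual is EQUIVALENT to g27's
residual off both decomposition cells. [folklore] -/
theorem nonKHToricArchLUKeyHenselDescentAbel_iff_dec {e c n : ℕ} :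
    TameAbelianQuotientLU.NonKHToricArchLUKeyHenselDescentAbel e c n ↔
      NonKHToricArchLUKeyHenselDescentQuotDec e c n :=
  TameAbelianQuotientLU.nonKHToricArchLUKeyHenselDescentQuot_iff_abel.symm.trans
    nonKHToricArchLUKeyHenselDescentQuot_iff_dec

/-- At the programme's parameters. [folklore] -/
theorem nonKHToricArchLUKeyHenselDescentAbel334_iff_dec :
    TameAbelianQuotientLU.NonKHToricArchLUKeyHenselDescentAbel 3 3 4 ↔
      NonKHToricArchLUKeyHenselDescentQuotDec 3 3 4 :=
  nonKHToricArchLUKeyHenselDescentAbel_iff_dec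

end Summit.ResolutionOfSingularities.ResolutionOfSingularities.Theorems.DecompositionDescentLU
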